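import Summits.ResolutionOfSingularities.KangarooAtlas.MizutaniDigitArrays
import HarnessLib

/-!
# Mizutani's conjecture `m(e) = 2p^e − 1` — the DIGIT LEMMA, part N (digits, counting, Lucas)

Cell topic `Summits/ResolutionOfSingularities/KangarooAtlas` (pub-rosobs).  Last part of the kernel
certificate of the DIGIT LEMMA of MIZUTANI-PROOF-g59 §4 (in-house, AI-written, AI-audited; *AI review is
weaker than expert review*; not a resolution theorem): `DigitLemma.digit p n l = n / p^l % p`,
`DigitLemma.DigitLE` (digitwise domination `T ≤_d N`), base-`p` expansion, `digit_lemma_nat` /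
`digit_lemma` (two distinct `T ≠ T'` digitwise below a genuine `N` with `|T| = |T'| = m`,
`1 ≤ m ≤ p^e − 1`), the counting forms `digit_lemma_card` (`c_m(N) ≥ 2`) and `digit_lemma_cumulative`
(`#{T ≤_d N : |T| ≤ i} ≥ 2i+1` for `i ≤ p^e − 1`, the combinatorial content of `σ_i(t^N) ≥ 2i + 1`), the
Lucas dictionary `digitLE_iff_not_dvd_choose` (prime `p`: `T ≤_d N ⟺ p ∤ C(N,T)`, from Mathlib's
`Choose.lucas_theorem`) with `digit_lemma_lucas`, and the headline `MizutaniDigitLemma`,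
`MizutaniDigitLemma_cumulative`.  `p ≥ 2` arbitrary except in the Lucas dictionary.
References: [Mizutani1973HironakaGroupSchemes] (Remark 2.10; in-house proof §4); Lucas via Mathlib.
-/

open Finset

namespace Summit.ResolutionOfSingularities.KangarooAtlas.Mizutani.DigitLemma

variable {D : ℕ → ℕ} {p e : ℕ}

/-- base-`p` digit number `l` of `n` — the form `n / p^l % p` of Mathlib's Lucas theorem
(`Choose.lucas_theorem`). [cite: Mizutani1973HironakaGroupSchemes, Remark 2.10 (in-house proof MIZUTANI-PROOF-g59 §4, Digit Lemma)] -/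
def digit (p n l : ℕ) : ℕ := n / p ^ l % p

/-- digitwise domination `T ≤_d N` in base `p` (by Lucas: `binom(N,T) ≢ 0 mod p`, for prime `p`). [cite: Mizutani1973HironakaGroupSchemes, Remark 2.10 (in-house proof MIZUTANI-PROOF-g59 §4, Digit Lemma)] -/
def DigitLE (p T N : ℕ) : Prop := ∀ l, digit p T l ≤ digit p N l

/-- Helper step `digit_lt` of the Digit Lemma certificate (MIZUTANI-PROOF-g59 §4). [folklore] -/
lemma digit_lt (hp : 0 < p) (n l : ℕ) : digit p n l < p := Nat.mod_lt _ hp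

/-- Helper step `digit_eq_zero_of_lt` of the Digit Lemma certificate (MIZUTANI-PROOF-g59 §4). [folklore] -/
lemma digit_eq_zero_of_lt {n l : ℕ} (h : n < p ^ l) : digit p n l = 0 := by
  simp [digit, Nat.div_eq_of_lt h]

/-- Helper step `digit_eq_zero_of_le` of the Digit Lemma certificate (MIZUTANI-PROOF-g59 §4). [folklore] -/
lemma digit_eq_zero_of_le (hp : 2 ≤ p) {n e l : ℕ} (hn : n < p ^ e) (hl : e ≤ l) :
    digit p n l = 0 :=
  digit_eq_zero_of_lt (lt_of_lt_of_le hn (Nat.pow_le_pow_right (by omega) hl))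

/-- Helper step `digit_zero` of the Digit Lemma certificate (MIZUTANI-PROOF-g59 §4). [folklore] -/
lemma digit_zero (n : ℕ) : digit p n 0 = n % p := by simp [digit]

/-- Helper step `digit_succ` of the Digit Lemma certificate (MIZUTANI-PROOF-g59 §4). [folklore] -/
lemma digit_succ (n l : ℕ) : digit p n (l + 1) = digit p (n / p) l := by
  simp only [digit, pow_succ', Nat.div_div_eq_div_mul]

/-- base-`p` expansion: `n = ∑_{l<e} digit_l(n) p^l` for `n < p^e`. [folklore] -/
theorem expand (hp : 2 ≤ p) : ∀ e n, n < p ^ e → ∑ l ∈ range e, digit p n l * p ^ l = n := by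
  intro e
  induction e with
  | zero => intro n hn; simp at hn; simp [hn]
  | succ e ih =>
    intro n hn
    have hpos : 0 < p := by omega
    rw [sum_range_succ']
    simp only [digit_succ, digit_zero, pow_zero, mul_one, pow_succ]
    have hdiv : n / p < p ^ e := by
      rw [Nat.div_lt_iff_lt_mul hpos]; simpa [pow_succ] using hn
    have := ih (n / p) hdiv
    calc ∑ l ∈ range e, digit p (n / p) l * (p ^ l * p) + n % p
        = (∑ l ∈ range e, digit p (n / p) l * p ^ l) * p + n % p := by
          rw [sum_mul]; congr 1; apply sum_congr rfl; intro l _; ring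
      _ = n := by rw [this, mul_comm]; exact Nat.div_add_mod n p

/-- digits of a number assembled from digits. [folklore] -/
theorem digit_ofDigits (hp : 2 ≤ p) : ∀ (e : ℕ) (t : ℕ → ℕ), (∀ l, t l < p) →
    ∀ l, digit p (∑ k ∈ range e, t k * p ^ k) l = if l < e then t l else 0 := by
  intro e
  induction e with
  | zero => intro t _ l; simp [digit]
  | succ e ih =>
    intro t ht l
    have hpos : 0 < p := by omega
    have hsplit : ∑ k ∈ range (e + 1), t k * p ^ k = t 0 + p * ∑ k ∈ range e, t (k + 1) * p ^ k := by
      rw [sum_range_succ', mul_sum]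
      simp only [pow_zero, mul_one, pow_succ]
      rw [add_comm]; congr 1; apply sum_congr rfl; intro k _; ring
    rw [hsplit]
    cases l with
    | zero =>
      rw [digit_zero, Nat.add_mul_mod_self_left, Nat.mod_eq_of_lt (ht 0)]
      simp
    | succ l =>
      rw [digit_succ, Nat.add_mul_div_left _ _ hpos, Nat.div_eq_of_lt (ht 0), zero_add]
      rw [ih (fun k => t (k + 1)) (fun k => ht (k + 1)) l]
      simp

/-- digitwise domination implies domination (for `p ≥ 2`). [folklore] -/
theorem le_of_digitLE (hp : 2 ≤ p) {T N : ℕ} (h : DigitLE p T N) : T ≤ N := by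
  -- expand both below a common bound
  obtain ⟨e, heT, heN⟩ : ∃ e, T < p ^ e ∧ N < p ^ e := by
    refine ⟨T + N, ?_, ?_⟩
    · calc T < 2 ^ T := Nat.lt_two_pow_self
        _ ≤ p ^ T := Nat.pow_le_pow_left hp T
        _ ≤ p ^ (T + N) := Nat.pow_le_pow_right (by omega) (by omega)
    · calc N < 2 ^ N := Nat.lt_two_pow_self
        _ ≤ p ^ N := Nat.pow_le_pow_left hp N
        _ ≤ p ^ (T + N) := Nat.pow_le_pow_right (by omega) (by omega)
  rw [← expand hp e T heT, ← expand hp e N heN]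
  exact sum_le_sum (fun l _ => Nat.mul_le_mul_right _ (h l))

/-- THE DIGIT LEMMA (coordinates indexed by `i < s`).  `N i < p^e`, `∑ N i ≥ p^e`,
`∑ ⌊N i / p⌋ ≤ p^(e-1) - 1`; then every `1 ≤ m ≤ p^e - 1` is the degree of two distinct
exponent vectors `T ≠ T'` digitwise dominated by `N`. [cite: Mizutani1973HironakaGroupSchemes, Remark 2.10 (in-house proof MIZUTANI-PROOF-g59 §4, Digit Lemma)] -/
theorem digit_lemma_nat (hp : 2 ≤ p) (s e : ℕ) (N : ℕ → ℕ) (hN : ∀ i, N i < p ^ e)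
    (hW : p ^ e ≤ ∑ i ∈ range s, N i) (hF : ∑ i ∈ range s, N i / p ≤ p ^ (e - 1) - 1)
    {m : ℕ} (hm1 : 1 ≤ m) (hm2 : m + 1 ≤ p ^ e) :
    ∃ T T' : ℕ → ℕ, (∃ i, i < s ∧ T i ≠ T' i) ∧
      (∀ i, DigitLE p (T i) (N i)) ∧ (∀ i, DigitLE p (T' i) (N i)) ∧
      ∑ i ∈ range s, T i = m ∧ ∑ i ∈ range s, T' i = m := by
  classical
  have hpos : 0 < p := by omega
  have he : 1 ≤ e := by
    by_contra he; push Not at he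
    have : e = 0 := by omega
    subst this; simp at hm2; omega
  -- the capacity array of digits
  let d : ℕ → ℕ → ℕ := fun i l => if i < s then digit p (N i) l else 0
  have hd : ∀ i l, d i l ≤ p - 1 := by
    intro i l; simp only [d]; split_ifs
    · have := digit_lt hpos (N i) l; omega
    · omega
  have hds : ∀ i l, s ≤ i → d i l = 0 := by
    intro i l hi; simp [d, Nat.not_lt.mpr hi]
  have hde : ∀ i l, e ≤ l → d i l = 0 := by
    intro i l hl; simp only [d]; split_ifs
    · exact digit_eq_zero_of_le hp (hN i) hl
    · rfl
  have hDl : ∀ l, levelSum d s l = ∑ i ∈ range s, digit p (N i) l := by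
    intro l; unfold levelSum
    apply sum_congr rfl; intro i hi; simp [d, mem_range.mp hi]
  -- M e = ∑ N i
  have hM : M (levelSum d s) p e = ∑ i ∈ range s, N i := by
    unfold M
    simp_rw [hDl, sum_mul]
    rw [sum_comm]
    apply sum_congr rfl; intro i _
    exact expand hp e (N i) (hN i)
  -- F = ∑ ⌊N i / p⌋
  have hFeq : F (levelSum d s) p e = ∑ i ∈ range s, N i / p := by
    unfold F
    simp_rw [hDl, sum_mul]
    rw [sum_comm]
    apply sum_congr rfl; intro i _
    simp_rw [digit_succ]
    apply expand hp (e - 1) (N i / p)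
    rw [Nat.div_lt_iff_lt_mul hpos]
    calc N i < p ^ e := hN i
      _ = p ^ (e - 1) * p := by rw [← pow_succ]; congr 1; omega
  obtain ⟨t, t', hne, ht, ht', hwt, hwt'⟩ :=
    two_fillings hp d hd hds hde (by rw [hM]; exact hW) (by rw [hFeq]; exact hF) hm1 hm2
  -- assemble numbers from the fillings
  let T : ℕ → ℕ := fun i => ∑ l ∈ range e, t i l * p ^ l
  let T' : ℕ → ℕ := fun i => ∑ l ∈ range e, t' i l * p ^ l
  have htlt : ∀ i l, t i l < p := fun i l => by have := ht i l; have := hd i l; omega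
  have ht'lt : ∀ i l, t' i l < p := fun i l => by have := ht' i l; have := hd i l; omega
  have hdigT : ∀ i l, digit p (T i) l = if l < e then t i l else 0 :=
    fun i l => digit_ofDigits hp e (t i) (htlt i) l
  have hdigT' : ∀ i l, digit p (T' i) l = if l < e then t' i l else 0 :=
    fun i l => digit_ofDigits hp e (t' i) (ht'lt i) l
  have hdN : ∀ i l, d i l ≤ digit p (N i) l := by
    intro i l; simp only [d]; split_ifs <;> simp
  refine ⟨T, T', ?_, ?_, ?_, hwt, hwt'⟩
  · -- distinct inside the box
    by_contra H
    push Not at H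
    apply hne
    funext i l
    by_cases hi : i < s
    · by_cases hl : l < e
      · have h1 := hdigT i l
        have h2 := hdigT' i l
        rw [H i hi] at h1
        rw [h1] at h2
        simpa [hl] using h2
      · have h1 := ht i l; have h2 := ht' i l
        rw [hde i l (by omega)] at h1 h2
        omega
    · have h1 := ht i l; have h2 := ht' i l
      rw [hds i l (by omega)] at h1 h2
      omega
  · intro i l; rw [hdigT]; split_ifs
    · exact le_trans (ht i l) (hdN i l)
    · exact Nat.zero_le _
  · intro i l; rw [hdigT']; split_ifs
    · exact le_trans (ht' i l) (hdN i l)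
    · exact Nat.zero_le _

/-- THE DIGIT LEMMA (MIZUTANI-PROOF-g59 §4), `Fin s`-indexed form.  For `N : Fin s → ℕ` with
`N i < q = p^e`, `|N| ≥ q` and `floor N = ∑ ⌊N i/p⌋ ≤ p^(e-1) - 1` ("`N` genuine"), every
`1 ≤ m ≤ q - 1` satisfies `c_m(N) ≥ 2`: there are two distinct `T ≠ T'`, digitwise dominated by
`N` coordinatewise, with `|T| = |T'| = m`. [cite: Mizutani1973HironakaGroupSchemes, Remark 2.10 (in-house proof MIZUTANI-PROOF-g59 §4, Digit Lemma)] -/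
theorem digit_lemma (hp : 2 ≤ p) {s e : ℕ} (N : Fin s → ℕ) (hN : ∀ i, N i < p ^ e)
    (hW : p ^ e ≤ ∑ i, N i) (hF : ∑ i, N i / p ≤ p ^ (e - 1) - 1)
    {m : ℕ} (hm1 : 1 ≤ m) (hm2 : m ≤ p ^ e - 1) :
    ∃ T T' : Fin s → ℕ, T ≠ T' ∧ (∀ i, DigitLE p (T i) (N i)) ∧ (∀ i, DigitLE p (T' i) (N i)) ∧
      ∑ i, T i = m ∧ ∑ i, T' i = m := by
  have hpos : 0 < p := by omega
  let N' : ℕ → ℕ := fun i => if h : i < s then N ⟨i, h⟩ else 0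
  have hN'val : ∀ i : Fin s, N' i = N i := fun i => by simp [N', i.isLt]
  have hN' : ∀ i, N' i < p ^ e := by
    intro i; simp only [N']; split_ifs
    · exact hN _
    · exact pow_pos hpos e
  have hsum : ∑ i, N i = ∑ i ∈ range s, N' i := by
    rw [← Fin.sum_univ_eq_sum_range]
    exact Fintype.sum_congr _ _ (fun i => (hN'val i).symm)
  have hsum' : ∑ i, N i / p = ∑ i ∈ range s, N' i / p := by
    rw [← Fin.sum_univ_eq_sum_range (fun i => N' i / p)]
    exact Fintype.sum_congr _ _ (fun i => by rw [hN'val i])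
  obtain ⟨T, T', ⟨i₀, hi₀, hne⟩, hT, hT', hwT, hwT'⟩ :=
    digit_lemma_nat hp s e N' hN' (by rw [← hsum]; exact hW) (by rw [← hsum']; exact hF) hm1
      (by omega)
  refine ⟨fun i => T i, fun i => T' i, ?_, fun i => by simpa [hN'val] using hT i,
    fun i => by simpa [hN'val] using hT' i, ?_, ?_⟩
  · intro heq
    exact hne (congrFun heq ⟨i₀, hi₀⟩)
  · rw [← hwT, ← Fin.sum_univ_eq_sum_range]
  · rw [← hwT', ← Fin.sum_univ_eq_sum_range]

/-! ## Counting forms: `c_m(N) ≥ 2` and `#{T ≤_d N : |T| ≤ i} ≥ 2i + 1` -/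

/-- Helper step `digitLE_zero` of the Digit Lemma certificate (MIZUTANI-PROOF-g59 §4). [folklore] -/
lemma digitLE_zero (N : ℕ) : DigitLE p 0 N := fun l => by simp [digit]

open scoped Classical in
/-- `c_m(N) ≥ 2`: the set of exponent vectors `T ≤ N` (coordinatewise, in the box) that are
digitwise dominated by `N` and have degree `m` has at least two elements. [cite: Mizutani1973HironakaGroupSchemes, Remark 2.10 (in-house proof MIZUTANI-PROOF-g59 §4, Digit Lemma)] -/
theorem digit_lemma_card (hp : 2 ≤ p) {s e : ℕ} (N : Fin s → ℕ) (hN : ∀ i, N i < p ^ e)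
    (hW : p ^ e ≤ ∑ i, N i) (hF : ∑ i, N i / p ≤ p ^ (e - 1) - 1)
    {m : ℕ} (hm1 : 1 ≤ m) (hm2 : m ≤ p ^ e - 1) :
    2 ≤ ((Fintype.piFinset fun i => range (N i + 1)).filter
      (fun T => (∀ i, DigitLE p (T i) (N i)) ∧ ∑ i, T i = m)).card := by
  obtain ⟨T, T', hne, hT, hT', hsT, hsT'⟩ := digit_lemma hp N hN hW hF hm1 hm2
  have mem : ∀ U : Fin s → ℕ, (∀ i, DigitLE p (U i) (N i)) → ∑ i, U i = m →
      U ∈ (Fintype.piFinset fun i => range (N i + 1)).filter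
        (fun T => (∀ i, DigitLE p (T i) (N i)) ∧ ∑ i, T i = m) := by
    intro U hU hsU
    rw [mem_filter, Fintype.mem_piFinset]
    exact ⟨fun i => mem_range.mpr (Nat.lt_succ_of_le (le_of_digitLE hp (hU i))), hU, hsU⟩
  have := Finset.one_lt_card.mpr ⟨T, mem T hT hsT, T', mem T' hT' hsT', hne⟩
  omega

open scoped Classical in
/-- cumulative form (the combinatorial shadow of `σ_i(t^N) ≥ 2i + 1`): for `0 ≤ i ≤ q - 1`
there are at least `2i + 1` exponent vectors `T` digitwise dominated by `N` with `|T| ≤ i`. [cite: Mizutani1973HironakaGroupSchemes, Remark 2.10 (in-house proof MIZUTANI-PROOF-g59 §4, Digit Lemma)] -/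
theorem digit_lemma_cumulative (hp : 2 ≤ p) {s e : ℕ} (N : Fin s → ℕ) (hN : ∀ i, N i < p ^ e)
    (hW : p ^ e ≤ ∑ i, N i) (hF : ∑ i, N i / p ≤ p ^ (e - 1) - 1) :
    ∀ i, i ≤ p ^ e - 1 → 2 * i + 1 ≤ ((Fintype.piFinset fun j => range (N j + 1)).filter
      (fun T => (∀ j, DigitLE p (T j) (N j)) ∧ ∑ j, T j ≤ i)).card := by
  intro i
  induction i with
  | zero =>
    intro _
    have h0 : (fun _ => (0 : ℕ)) ∈ (Fintype.piFinset fun j => range (N j + 1)).filter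
        (fun T => (∀ j, DigitLE p (T j) (N j)) ∧ ∑ j, T j ≤ 0) := by
      rw [mem_filter, Fintype.mem_piFinset]
      exact ⟨fun j => mem_range.mpr (Nat.succ_pos _), fun j => digitLE_zero (N j), by simp⟩
    have := Finset.card_pos.mpr ⟨_, h0⟩
    omega
  | succ i ih =>
    intro hi
    set box := Fintype.piFinset fun j => range (N j + 1) with hbox
    set A := box.filter (fun T => (∀ j, DigitLE p (T j) (N j)) ∧ ∑ j, T j ≤ i) with hA
    set B := box.filter (fun T => (∀ j, DigitLE p (T j) (N j)) ∧ ∑ j, T j = i + 1) with hB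
    set C := box.filter (fun T => (∀ j, DigitLE p (T j) (N j)) ∧ ∑ j, T j ≤ i + 1) with hC
    have hAcard : 2 * i + 1 ≤ A.card := ih (by omega)
    have hBcard : 2 ≤ B.card := digit_lemma_card hp N hN hW hF (by omega) hi
    have hdisj : Disjoint A B := by
      rw [hA, hB, Finset.disjoint_filter]
      intro T _ h1 h2; omega
    have hsub : A.disjUnion B hdisj ⊆ C := by
      intro T hT
      rw [Finset.mem_disjUnion] at hT
      rw [hC, mem_filter]
      rcases hT with hT | hT
      · rw [hA, mem_filter] at hT; exact ⟨hT.1, hT.2.1, by omega⟩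
      · rw [hB, mem_filter] at hT; exact ⟨hT.1, hT.2.1, by omega⟩
    have := Finset.card_le_card hsub
    rw [Finset.card_disjUnion] at this
    omega

/-! ## Lucas: digitwise domination = non-vanishing of `binom(N, T)` mod `p` (prime `p`) -/

/-- Helper step `not_dvd_choose_of_lt` of the Digit Lemma certificate (MIZUTANI-PROOF-g59 §4). [folklore] -/
lemma not_dvd_choose_of_lt {a b : ℕ} (hp : p.Prime) (ha : a < p) (hb : b ≤ a) :
    ¬ p ∣ a.choose b := by
  intro h
  have hfac : a.choose b * b.factorial * (a - b).factorial = a.factorial :=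
    Nat.choose_mul_factorial_mul_factorial hb
  have : p ∣ a.factorial := by
    rw [← hfac, mul_assoc]; exact Dvd.dvd.mul_right h _
  have := hp.dvd_factorial.mp this
  omega

/-- Helper step `dvd_choose_iff_lt_of_lt` of the Digit Lemma certificate (MIZUTANI-PROOF-g59 §4). [folklore] -/
lemma dvd_choose_iff_lt_of_lt (hp : p.Prime) {a b : ℕ} (ha : a < p) :
    p ∣ a.choose b ↔ a < b := by
  constructor
  · intro h; by_contra hab; push Not at hab; exact not_dvd_choose_of_lt hp ha hab h
  · intro h; rw [Nat.choose_eq_zero_of_lt h]; exact dvd_zero p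

/-- Helper step `exists_common_bound` of the Digit Lemma certificate (MIZUTANI-PROOF-g59 §4). [folklore] -/
lemma exists_common_bound (hp : 2 ≤ p) (T N : ℕ) : ∃ a, T < p ^ a ∧ N < p ^ a := by
  refine ⟨T + N, ?_, ?_⟩
  · calc T < 2 ^ T := Nat.lt_two_pow_self
      _ ≤ p ^ T := Nat.pow_le_pow_left hp T
      _ ≤ p ^ (T + N) := Nat.pow_le_pow_right (by omega) (by omega)
  · calc N < 2 ^ N := Nat.lt_two_pow_self
      _ ≤ p ^ N := Nat.pow_le_pow_left hp N
      _ ≤ p ^ (T + N) := Nat.pow_le_pow_right (by omega) (by omega)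

/-- For a prime `p`: `T ≤_d N` digitwise in base `p` iff `p ∤ binom(N, T)` (Lucas).  This is the
condition `binom(N, T) ≠ 0 in 𝔽_p` that governs the supports of `(D^{(T)} ⊗ 1) t^N` and the rank of
`t^N` (MIZUTANI-PROOF-g59 §1.3 (F2), §1.4 MONOMIALS). [cite: Mizutani1973HironakaGroupSchemes, Remark 2.10 (in-house proof MIZUTANI-PROOF-g59 §4, Digit Lemma)] -/
theorem digitLE_iff_not_dvd_choose [hp : Fact p.Prime] (T N : ℕ) :
    DigitLE p T N ↔ ¬ p ∣ N.choose T := by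
  have hp2 : 2 ≤ p := hp.out.two_le
  have hpos : 0 < p := hp.out.pos
  obtain ⟨a, hT, hN⟩ := exists_common_bound hp2 T N
  have hluc := Choose.lucas_theorem (p := p) (a := a) hN hT
  have hz : ((N.choose T : ℕ) : ZMod p) =
      ∏ i ∈ range a, (((N / p ^ i % p).choose (T / p ^ i % p) : ℕ) : ZMod p) := by
    have := (ZMod.intCast_eq_intCast_iff _ _ p).mpr hluc
    push_cast at this
    exact this
  have hdvd : p ∣ N.choose T ↔ ∃ i ∈ range a, digit p N i < digit p T i := by
    rw [← ZMod.natCast_eq_zero_iff, hz, Finset.prod_eq_zero_iff]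
    apply exists_congr; intro i
    apply and_congr_right; intro _
    rw [ZMod.natCast_eq_zero_iff]
    exact dvd_choose_iff_lt_of_lt hp.out (Nat.mod_lt _ hpos)
  rw [hdvd]
  constructor
  · rintro h ⟨i, _, hi⟩
    exact absurd (h i) (not_le.mpr hi)
  · intro h i
    by_contra hlt
    push Not at hlt
    by_cases hi : i < a
    · exact h ⟨i, mem_range.mpr hi, hlt⟩
    · rw [digit_eq_zero_of_le hp2 hT (not_lt.mp hi)] at hlt
      omega

/-! ## Headline statements (all binders explicit) -/

/-- **Digit Lemma, Lucas form** (prime `p`): for a genuine exponent vector `N` (all `N i < q = p^e`,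
`|N| ≥ q`, `∑ ⌊N i / p⌋ ≤ p^(e-1) - 1`) and every degree `1 ≤ m ≤ q - 1` there are two distinct
`T ≠ T'` of degree `m` with `p ∤ ∏ binom(N i, T i)`-factors, i.e. `binom(N i, T i) ≢ 0 (mod p)`
for every `i`. [cite: Mizutani1973HironakaGroupSchemes, Remark 2.10 (in-house proof MIZUTANI-PROOF-g59 §4, Digit Lemma)] -/
theorem digit_lemma_lucas [Fact p.Prime] {s e : ℕ} (N : Fin s → ℕ) (hN : ∀ i, N i < p ^ e)
    (hW : p ^ e ≤ ∑ i, N i) (hF : ∑ i, N i / p ≤ p ^ (e - 1) - 1)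
    {m : ℕ} (hm1 : 1 ≤ m) (hm2 : m ≤ p ^ e - 1) :
    ∃ T T' : Fin s → ℕ, T ≠ T' ∧ (∀ i, ¬ p ∣ (N i).choose (T i)) ∧
      (∀ i, ¬ p ∣ (N i).choose (T' i)) ∧ ∑ i, T i = m ∧ ∑ i, T' i = m := by
  have hp2 : 2 ≤ p := (Fact.out : p.Prime).two_le
  obtain ⟨T, T', hne, hT, hT', hs, hs'⟩ := digit_lemma hp2 N hN hW hF hm1 hm2
  exact ⟨T, T', hne, fun i => (digitLE_iff_not_dvd_choose _ _).mp (hT i),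
    fun i => (digitLE_iff_not_dvd_choose _ _).mp (hT' i), hs, hs'⟩

end Summit.ResolutionOfSingularities.KangarooAtlas.Mizutani.DigitLemma

namespace Summit.ResolutionOfSingularities.KangarooAtlas.Mizutani

open DigitLemma

/-- **THE DIGIT LEMMA of MIZUTANI-PROOF-g59 §4** (pub-rosobs invariant-census lane, gens 58/59;
kernel certificate gen 61), for every base `p ≥ 2`, every `e` and every number of coordinates `s`.
`DigitLemma.DigitLE p T N` is digitwise domination `T ≤_d N` in base `p`
(`∀ l, T / p^l % p ≤ N / p^l % p`; for prime `p` equivalently `p ∤ binom(N, T)`,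
`DigitLemma.digitLE_iff_not_dvd_choose`). [cite: Mizutani1973HironakaGroupSchemes, Remark 2.10 (in-house proof MIZUTANI-PROOF-g59 §4, Digit Lemma)] -/
theorem MizutaniDigitLemma (p : ℕ) (hp : 2 ≤ p) (s e : ℕ) (N : Fin s → ℕ)
    (hN : ∀ i, N i < p ^ e) (hW : p ^ e ≤ ∑ i, N i) (hF : ∑ i, N i / p ≤ p ^ (e - 1) - 1)
    (m : ℕ) (hm1 : 1 ≤ m) (hm2 : m ≤ p ^ e - 1) :
    ∃ T T' : Fin s → ℕ, T ≠ T' ∧ (∀ i, DigitLemma.DigitLE p (T i) (N i)) ∧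
      (∀ i, DigitLemma.DigitLE p (T' i) (N i)) ∧ ∑ i, T i = m ∧ ∑ i, T' i = m :=
  DigitLemma.digit_lemma hp N hN hW hF hm1 hm2

open scoped Classical in
/-- cumulative count: `#{T in the box : T ≤_d N coordinatewise, |T| ≤ i} ≥ 2i + 1` for
`0 ≤ i ≤ q - 1` — the combinatorial content of `σ_i(t^N) ≥ 2i + 1` (MIZUTANI-PROOF-g59 §4, last
sentence; the identification `σ_i(t^N) = #{T ≤_d N : |T| ≤ i}` is §1.4 MONOMIALS, not certified here). [cite: Mizutani1973HironakaGroupSchemes, Remark 2.10 (in-house proof MIZUTANI-PROOF-g59 §4, Digit Lemma)] -/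
theorem MizutaniDigitLemma_cumulative (p : ℕ) (hp : 2 ≤ p) (s e : ℕ) (N : Fin s → ℕ)
    (hN : ∀ i, N i < p ^ e) (hW : p ^ e ≤ ∑ i, N i) (hF : ∑ i, N i / p ≤ p ^ (e - 1) - 1)
    (i : ℕ) (hi : i ≤ p ^ e - 1) :
    2 * i + 1 ≤ ((Fintype.piFinset fun j => Finset.range (N j + 1)).filter
      (fun T => (∀ j, DigitLemma.DigitLE p (T j) (N j)) ∧ ∑ j, T j ≤ i)).card :=
  DigitLemma.digit_lemma_cumulative hp N hN hW hF i hi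

end Summit.ResolutionOfSingularities.KangarooAtlas.Mizutani
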